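import Summits.AtomisticToContinuum.HydrodynamicLimit.Theses.AntiMazurCoboundaries
import Summits.AtomisticToContinuum.HydrodynamicLimit.Theorems.JParityClosureOddContactSymmetryGibbsInvariance
import Summits.AtomisticToContinuum.HydrodynamicLimit.Theorems.BoltzmannGreenKubo.Negative.JointMeasurability
import Literature.Analysis.FluidPDE.HardSphereFlowJointMeasurable

/-!
# The exponential anti-Mazur certificate and the transfer `CorrectorPressureDecay → KineticFluxLdDecay`

Route `AntiMazurCoboundaries` of `AtomisticToContinuum/HydrodynamicLimit`, support item
stmt-AtomisticToContinuum-14139 (`PressureCertificateTransfer`).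

* `AntiMazurCertificate.lintegral_exp_window_le` — the EXPONENTIAL ANTI-MAZUR CERTIFICATE (mechanism of the
  route's support item `ExponentialCertificate`, any particle number): for a hard-sphere flow `Φ` on `𝕋³`, an
  s-finite law `μ` preserved by every `Φ_t` and carried by the good set, bounded measurable `F, W`, `h, lag > 0`:
  `∫ exp(h⁻¹∫₀ʰ F(Φ_s z) ds) dμ ≤ (∫ exp(2(F − lag⁻¹(W∘Φ_lag − W))) dμ)^½ · (∫ exp(4h⁻¹|W|) dμ)^½`.
  Proof: pathwise telescoping `h⁻¹∫₀ʰ F∘Φ_s = h⁻¹∫₀ʰ (F − D_W)∘Φ_s + B`,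
  `B = (h·lag)⁻¹ [∫_h^{h+lag} − ∫_0^{lag}] W∘Φ_u` (group property on the good set); Cauchy–Schwarz in `μ`;
  Jensen in `s` + Tonelli (joint measurability of the flow modified off the good set,
  `BoltzmannGreenKuboOrthMomentum.aemeasurable_uncurry_flow`) + invariance of `μ`;
  `e^{2B} ≤ ½(e^{(4/h)·avg₁|W∘Φ|} + e^{(4/h)·avg₂|W∘Φ|})`.
* `pressureCertificateTransfer_proof` — the route decl `PressureCertificateTransfer`
  (`CorrectorPressureDecay → KineticFluxLdDecay`): `τ := τ₀`, same `N₀`; the certificate for `μ = G_N` (the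
  constant-profile Gibbs law: invariant, `measurePreserving_flow_localGibbsLaw_const`; `≪` Liouville, so
  `G_N(goodᶜ) = 0`), `F = Σᵢ φ(xᵢ) g((vᵢ − u₀)/√θ)`, the given `W`, `lag`, and `h = τ₀ (N+1)^{-1/3}`.

References: Kipnis–Landim, *Scaling Limits of Interacting Particle Systems* (1999), Ch. 7 §2 (the corrector
device of the nongradient method, reversible-Markov analogue); Olla–Varadhan–Yau, CMP 155 (1993) §3.
-/

noncomputable section

open MeasureTheory Set Filter
open scoped ENNReal Interval

namespace Summit.AtomisticToContinuum.HydrodynamicLimit.Theorems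

open Literature.Analysis.FluidPDE Literature.MathematicalPhysics.KineticTheory

namespace AntiMazurCertificate

variable {N : ℕ} {ε : ℝ}

/-- Good orbits of a hard-sphere flow on `𝕋³` are measurable in time (section of the jointly measurable
modified flow `BoltzmannGreenKuboOrthMomentum.flowMod`). [folklore] -/
theorem measurable_flow_orbit (Φ : HardSphereFlow (Torus.geometry (Fin 3)) ε N)
    {z : Config N (Fin 3) T3} (hz : z ∈ Φ.good) : Measurable fun s : ℝ => Φ.flow s z := by
  have h : (fun s : ℝ => Φ.flow s z) =
      fun s => BoltzmannGreenKuboOrthMomentum.flowMod Φ (s, z) := by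
    funext s
    rw [BoltzmannGreenKuboOrthMomentum.flowMod_of_mem Φ hz]
  rw [h]
  exact (BoltzmannGreenKuboOrthMomentum.measurable_flowMod Φ).comp (measurable_id.prodMk measurable_const)

/-- A bounded measurable observable evaluated along a good orbit is integrable on every bounded time
interval. [folklore] -/
theorem intervalIntegrable_comp_flow (Φ : HardSphereFlow (Torus.geometry (Fin 3)) ε N)
    {z : Config N (Fin 3) T3} (hz : z ∈ Φ.good) {f : Config N (Fin 3) T3 → ℝ} (hf : Measurable f)
    {C : ℝ} (hC : ∀ z, |f z| ≤ C) (a b : ℝ) :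
    IntervalIntegrable (fun s => f (Φ.flow s z)) volume a b := by
  rw [intervalIntegrable_iff]
  refine IntegrableOn.of_bound ?_ (hf.comp (measurable_flow_orbit Φ hz)).aestronglyMeasurable C
    (ae_of_all _ fun s => ?_)
  · rw [uIoc, Real.volume_Ioc]
    exact ENNReal.ofReal_lt_top
  · rw [Real.norm_eq_abs]
    exact hC _

/-- **Tonelli + invariance**: for a law `μ` preserved by every `Φ_t` and carried by the good set and a
measurable `G ≥ 0`, `∫ (∫_{(a,b]} G(Φ_s z) ds) dμ = |(a,b]| · ∫ G dμ`. [folklore] -/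
theorem lintegral_setLIntegral_comp_flow (Φ : HardSphereFlow (Torus.geometry (Fin 3)) ε N)
    (μ : Measure (Config N (Fin 3) T3)) [SFinite μ] (hinv : ∀ t, MeasurePreserving (Φ.flow t) μ μ)
    (hgood : μ Φ.goodᶜ = 0) {G : Config N (Fin 3) T3 → ℝ≥0∞} (hG : Measurable G) (a b : ℝ) :
    ∫⁻ z, (∫⁻ s in Ioc a b, G (Φ.flow s z)) ∂μ = volume (Ioc a b) * ∫⁻ z, G z ∂μ := by
  set ν : Measure ℝ := volume.restrict (Ioc a b) with hν
  have hflow : AEMeasurable (fun p : ℝ × Config N (Fin 3) T3 => Φ.flow p.1 p.2) (ν.prod μ) :=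
    BoltzmannGreenKuboOrthMomentum.aemeasurable_uncurry_flow Φ ν μ hgood
  have hGf : AEMeasurable (fun p : ℝ × Config N (Fin 3) T3 => G (Φ.flow p.1 p.2)) (ν.prod μ) :=
    hG.comp_aemeasurable hflow
  have h1 := lintegral_prod_symm _ hGf
  have h2 := lintegral_prod _ hGf
  simp only at h1 h2
  rw [← h1, h2]
  have h3 : ∀ s, ∫⁻ z, G (Φ.flow s z) ∂μ = ∫⁻ z, G z ∂μ := fun s => (hinv s).lintegral_comp hG
  simp only [h3, lintegral_const, hν, Measure.restrict_apply_univ]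
  rw [mul_comm]

/-- **Jensen along a good orbit**: for bounded measurable `f`, `a` and `ℓ > 0`,
`exp(ℓ⁻¹ ∫_a^{a+ℓ} f(Φ_s z) ds) ≤ ℓ⁻¹ ∫_a^{a+ℓ} exp(f(Φ_s z)) ds`. [folklore] -/
theorem exp_windowAverage_le (Φ : HardSphereFlow (Torus.geometry (Fin 3)) ε N)
    {z : Config N (Fin 3) T3} (hz : z ∈ Φ.good) {f : Config N (Fin 3) T3 → ℝ} (hf : Measurable f)
    {C : ℝ} (hC : ∀ z, |f z| ≤ C) (a : ℝ) {ℓ : ℝ} (hℓ : 0 < ℓ) :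
    Real.exp (ℓ⁻¹ * ∫ s in a..(a + ℓ), f (Φ.flow s z)) ≤
      ℓ⁻¹ * ∫ s in a..(a + ℓ), Real.exp (f (Φ.flow s z)) := by
  have hab : a ≤ a + ℓ := by linarith
  have hmeas : Measurable fun s => f (Φ.flow s z) := hf.comp (measurable_flow_orbit Φ hz)
  have hvol : volume (Ι a (a + ℓ)) = ENNReal.ofReal ℓ := by
    rw [uIoc_of_le hab, Real.volume_Ioc, add_sub_cancel_left]
  have h0 : volume (Ι a (a + ℓ)) ≠ 0 := by
    rw [hvol]
    exact (ENNReal.ofReal_pos.2 hℓ).ne'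
  have ht : volume (Ι a (a + ℓ)) ≠ ∞ := by
    rw [hvol]
    exact ENNReal.ofReal_ne_top
  have hfi : IntegrableOn (fun s => f (Φ.flow s z)) (Ι a (a + ℓ)) volume :=
    (intervalIntegrable_iff.1 (intervalIntegrable_comp_flow Φ hz hf hC a (a + ℓ)))
  have hgi : IntegrableOn (Real.exp ∘ fun s => f (Φ.flow s z)) (Ι a (a + ℓ)) volume := by
    refine IntegrableOn.of_bound ht.lt_top
      ((Real.measurable_exp.comp hmeas).aestronglyMeasurable) (Real.exp C) (ae_of_all _ fun s => ?_)
    simp only [Function.comp_apply, Real.norm_eq_abs, abs_of_pos (Real.exp_pos _)]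
    exact Real.exp_le_exp.2 ((le_abs_self _).trans (hC _))
  have hJ := ConvexOn.map_set_average_le convexOn_exp Real.continuous_exp.continuousOn isClosed_univ h0 ht
    (ae_of_all _ fun _ => mem_univ _) hfi hgi
  rw [interval_average_eq, interval_average_eq, smul_eq_mul, smul_eq_mul, add_sub_cancel_left] at hJ
  exact hJ

/-- **Jensen in time + Tonelli + invariance**: under a law preserved by the flow and carried by the good
set, the exponential moment of a window AVERAGE of a bounded measurable observable along the flow is at
most the static exponential moment: `∫ exp(ℓ⁻¹∫_a^{a+ℓ} f(Φ_s z) ds) dμ ≤ ∫ exp(f) dμ`. [folklore] -/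
theorem lintegral_exp_windowAverage_le (Φ : HardSphereFlow (Torus.geometry (Fin 3)) ε N)
    (μ : Measure (Config N (Fin 3) T3)) [SFinite μ] (hinv : ∀ t, MeasurePreserving (Φ.flow t) μ μ)
    (hgood : μ Φ.goodᶜ = 0) {f : Config N (Fin 3) T3 → ℝ} (hf : Measurable f) {C : ℝ}
    (hC : ∀ z, |f z| ≤ C) (a : ℝ) {ℓ : ℝ} (hℓ : 0 < ℓ) :
    ∫⁻ z, ENNReal.ofReal (Real.exp (ℓ⁻¹ * ∫ s in a..(a + ℓ), f (Φ.flow s z))) ∂μ ≤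
      ∫⁻ z, ENNReal.ofReal (Real.exp (f z)) ∂μ := by
  have hae : ∀ᵐ z ∂μ, z ∈ Φ.good := mem_ae_iff.2 hgood
  have hab : a ≤ a + ℓ := by linarith
  have hG : Measurable fun z => ENNReal.ofReal (Real.exp (f z)) := (Real.measurable_exp.comp hf).ennreal_ofReal
  calc ∫⁻ z, ENNReal.ofReal (Real.exp (ℓ⁻¹ * ∫ s in a..(a + ℓ), f (Φ.flow s z))) ∂μ
      ≤ ∫⁻ z, ENNReal.ofReal (ℓ⁻¹ * ∫ s in a..(a + ℓ), Real.exp (f (Φ.flow s z))) ∂μ :=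
        lintegral_mono_ae (hae.mono fun z hz => ENNReal.ofReal_le_ofReal
          (exp_windowAverage_le Φ hz hf hC a hℓ))
    _ = ∫⁻ z, ENNReal.ofReal ℓ⁻¹ * (∫⁻ s in Ioc a (a + ℓ), ENNReal.ofReal (Real.exp (f (Φ.flow s z)))) ∂μ := by
        refine lintegral_congr_ae (hae.mono fun z hz => ?_)
        have hi : IntegrableOn (fun s => Real.exp (f (Φ.flow s z))) (Ioc a (a + ℓ)) volume := by
          have h := intervalIntegrable_comp_flow Φ hz (f := fun w => Real.exp (f w))
            (Real.measurable_exp.comp hf) (C := Real.exp C) (fun w => ?_) a (a + ℓ)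
          · rw [intervalIntegrable_iff, uIoc_of_le hab] at h
            exact h
          · rw [abs_of_pos (Real.exp_pos _)]
            exact Real.exp_le_exp.2 ((le_abs_self _).trans (hC _))
        show ENNReal.ofReal (ℓ⁻¹ * ∫ s in a..(a + ℓ), Real.exp (f (Φ.flow s z))) =
          ENNReal.ofReal ℓ⁻¹ * ∫⁻ s in Ioc a (a + ℓ), ENNReal.ofReal (Real.exp (f (Φ.flow s z)))
        rw [ENNReal.ofReal_mul (inv_nonneg.2 hℓ.le), intervalIntegral.integral_of_le hab,
          ofReal_integral_eq_lintegral_ofReal hi (ae_of_all _ fun _ => (Real.exp_pos _).le)]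
    _ = ENNReal.ofReal ℓ⁻¹ * (volume (Ioc a (a + ℓ)) * ∫⁻ z, ENNReal.ofReal (Real.exp (f z)) ∂μ) := by
        rw [lintegral_const_mul' _ _ ENNReal.ofReal_ne_top,
          lintegral_setLIntegral_comp_flow Φ μ hinv hgood hG a (a + ℓ)]
    _ = ∫⁻ z, ENNReal.ofReal (Real.exp (f z)) ∂μ := by
        rw [Real.volume_Ioc, add_sub_cancel_left, ← mul_assoc, ← ENNReal.ofReal_mul (inv_nonneg.2 hℓ.le),
          inv_mul_cancel₀ hℓ.ne', ENNReal.ofReal_one, one_mul]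

/-- **Pathwise telescoping** on a good orbit: the window integral of the lag-`lag` coboundary of `W` is a
difference of two boundary integrals, `∫₀ʰ [W(Φ_lag(Φ_s z)) − W(Φ_s z)] ds = ∫_h^{h+lag} W(Φ_u z) du −
∫_0^{lag} W(Φ_u z) du` (group property `Φ_lag ∘ Φ_s = Φ_{lag+s}` on the good set; valid for all real
`h, lag`). [folklore] -/
theorem intervalIntegral_coboundary_comp_flow (Φ : HardSphereFlow (Torus.geometry (Fin 3)) ε N)
    {z : Config N (Fin 3) T3} (hz : z ∈ Φ.good) {W : Config N (Fin 3) T3 → ℝ} (hW : Measurable W)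
    {C : ℝ} (hC : ∀ z, |W z| ≤ C) (h lag : ℝ) :
    ∫ s in (0 : ℝ)..h, (W (Φ.flow lag (Φ.flow s z)) - W (Φ.flow s z)) =
      (∫ s in h..(h + lag), W (Φ.flow s z)) - ∫ s in (0 : ℝ)..lag, W (Φ.flow s z) := by
  have hI : ∀ a b : ℝ, IntervalIntegrable (fun s => W (Φ.flow s z)) volume a b :=
    fun a b => intervalIntegrable_comp_flow Φ hz hW hC a b
  have hgrp : ∀ s : ℝ, W (Φ.flow lag (Φ.flow s z)) = W (Φ.flow (s + lag) z) := by
    intro s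
    rw [add_comm s lag, Φ.flow_add lag s z hz]
  simp_rw [hgrp]
  have hshift : ∫ s in (0 : ℝ)..h, W (Φ.flow (s + lag) z) = ∫ s in lag..(h + lag), W (Φ.flow s z) := by
    rw [intervalIntegral.integral_comp_add_right (fun s => W (Φ.flow s z)) lag, zero_add]
  have hI' : IntervalIntegrable (fun s => W (Φ.flow (s + lag) z)) volume 0 h := by
    have := (hI (0 + lag) (h + lag)).comp_add_right lag
    simpa using this
  rw [intervalIntegral.integral_sub hI' (hI 0 h), hshift,
    ← intervalIntegral.integral_add_adjacent_intervals (hI lag h) (hI h (h + lag)),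
    ← intervalIntegral.integral_add_adjacent_intervals (hI 0 lag) (hI lag h)]
  ring

/-- Midpoint convexity of `exp`: `exp((a+b)/2) ≤ (exp a + exp b)/2`. [folklore] -/
theorem exp_half_add_le (a b : ℝ) : Real.exp (2⁻¹ * (a + b)) ≤ 2⁻¹ * (Real.exp a + Real.exp b) := by
  have h := convexOn_exp.2 (mem_univ a) (mem_univ b) (by norm_num : (0 : ℝ) ≤ 2⁻¹)
    (by norm_num : (0 : ℝ) ≤ 2⁻¹) (by norm_num : (2 : ℝ)⁻¹ + 2⁻¹ = 1)
  simp only [smul_eq_mul] at h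
  rw [mul_add, mul_add]
  exact h

/-- **The exponential anti-Mazur certificate.** For a hard-sphere flow `Φ` on `𝕋³` (any particle number and
diameter), an s-finite law `μ` preserved by every `Φ_t` and carried by the good set, bounded measurable
observables `F` (the flux) and `W` (the corrector), a window `h > 0` and a lag `lag > 0`:
`∫ exp(h⁻¹∫₀ʰ F(Φ_s z) ds) dμ ≤ (∫ exp(2(F − lag⁻¹(W∘Φ_lag − W))) dμ)^½ · (∫ exp(4h⁻¹|W|) dμ)^½`.
Pathwise telescoping + Cauchy–Schwarz + Jensen in time + invariance (the exponential, deterministic form of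
the corrector device of Varadhan's nongradient method, Kipnis–Landim 1999 Ch. 7 §2). [folklore] -/
theorem lintegral_exp_window_le (Φ : HardSphereFlow (Torus.geometry (Fin 3)) ε N)
    (μ : Measure (Config N (Fin 3) T3)) [SFinite μ] (hinv : ∀ t, MeasurePreserving (Φ.flow t) μ μ)
    (hgood : μ Φ.goodᶜ = 0) {F W : Config N (Fin 3) T3 → ℝ} (hF : Measurable F) (hW : Measurable W)
    (hFb : ∃ C : ℝ, ∀ z, |F z| ≤ C) (hWb : ∃ C : ℝ, ∀ z, |W z| ≤ C) {h lag : ℝ} (hh : 0 < h)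
    (hlag : 0 < lag) :
    ∫⁻ z, ENNReal.ofReal (Real.exp (h⁻¹ * ∫ s in (0 : ℝ)..h, F (Φ.flow s z))) ∂μ ≤
      (∫⁻ z, ENNReal.ofReal (Real.exp (2 * (F z - lag⁻¹ * (W (Φ.flow lag z) - W z)))) ∂μ) ^ (1 / 2 : ℝ) *
        (∫⁻ z, ENNReal.ofReal (Real.exp (4 * h⁻¹ * |W z|)) ∂μ) ^ (1 / 2 : ℝ) := by
  obtain ⟨CF, hCF⟩ := hFb
  obtain ⟨CW, hCW⟩ := hWb
  have hae : ∀ᵐ z ∂μ, z ∈ Φ.good := mem_ae_iff.2 hgood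
  -- the coboundary `D`, the corrected observable `Fd = F - D`, the cost density `f₄ = 4 h⁻¹ |W|`
  set D : Config N (Fin 3) T3 → ℝ := fun z => lag⁻¹ * (W (Φ.flow lag z) - W z) with hD
  have hDm : Measurable D := ((hW.comp (Φ.measurable_flow lag)).sub hW).const_mul _
  have hDb : ∀ z, |D z| ≤ |lag⁻¹| * (CW + CW) := fun z => by
    rw [hD, abs_mul]
    exact mul_le_mul_of_nonneg_left ((abs_sub _ _).trans (add_le_add (hCW _) (hCW _))) (abs_nonneg _)
  set Fd : Config N (Fin 3) T3 → ℝ := fun z => F z - D z with hFd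
  have hFdm : Measurable Fd := hF.sub hDm
  have hFdb : ∀ z, |Fd z| ≤ CF + |lag⁻¹| * (CW + CW) := fun z =>
    (abs_sub _ _).trans (add_le_add (hCF z) (hDb z))
  have hFd2m : Measurable fun z => 2 * Fd z := hFdm.const_mul 2
  have hFd2b : ∀ z, |2 * Fd z| ≤ 2 * (CF + |lag⁻¹| * (CW + CW)) := fun z => by
    rw [abs_mul, abs_two]
    exact mul_le_mul_of_nonneg_left (hFdb z) zero_le_two
  set f₄ : Config N (Fin 3) T3 → ℝ := fun z => 4 * h⁻¹ * |W z| with hf₄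
  have hf₄m : Measurable f₄ := (hW.abs).const_mul _
  have h4h : 0 ≤ 4 * h⁻¹ := by positivity
  have hf₄b : ∀ z, |f₄ z| ≤ 4 * h⁻¹ * CW := fun z => by
    rw [hf₄, abs_mul, abs_abs, abs_of_nonneg h4h]
    exact mul_le_mul_of_nonneg_left (hCW z) h4h
  -- the two factors `X = exp P`, `Y = exp B`
  set P : Config N (Fin 3) T3 → ℝ := fun z => h⁻¹ * ∫ s in (0 : ℝ)..h, Fd (Φ.flow s z) with hP
  set B : Config N (Fin 3) T3 → ℝ := fun z => h⁻¹ * (lag⁻¹ *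
    ((∫ s in h..(h + lag), W (Φ.flow s z)) - ∫ s in (0 : ℝ)..lag, W (Φ.flow s z))) with hB
  have hPm : AEMeasurable P μ :=
    (Φ.aemeasurable_intervalIntegral_comp_flow_torus hFdm 0 h hgood).const_mul _
  have hBm : AEMeasurable B μ :=
    (((Φ.aemeasurable_intervalIntegral_comp_flow_torus hW h (h + lag) hgood).sub
      (Φ.aemeasurable_intervalIntegral_comp_flow_torus hW 0 lag hgood)).const_mul _).const_mul _
  set X : Config N (Fin 3) T3 → ℝ≥0∞ := fun z => ENNReal.ofReal (Real.exp (P z)) with hX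
  set Y : Config N (Fin 3) T3 → ℝ≥0∞ := fun z => ENNReal.ofReal (Real.exp (B z)) with hY
  have hXm : AEMeasurable X μ := (Real.measurable_exp.comp_aemeasurable hPm).ennreal_ofReal
  have hYm : AEMeasurable Y μ := (Real.measurable_exp.comp_aemeasurable hBm).ennreal_ofReal
  -- (1) pathwise telescoping on the good set: `h⁻¹ ∫₀ʰ F∘Φ_s = P + B`
  have hsplit : ∀ z ∈ Φ.good, h⁻¹ * ∫ s in (0 : ℝ)..h, F (Φ.flow s z) = P z + B z := by
    intro z hz
    have hIFd := intervalIntegrable_comp_flow Φ hz hFdm hFdb 0 h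
    have hID := intervalIntegrable_comp_flow Φ hz hDm hDb 0 h
    have hdecomp : (fun s => F (Φ.flow s z)) = fun s => Fd (Φ.flow s z) + D (Φ.flow s z) := by
      funext s
      simp only [hFd, sub_add_cancel]
    rw [hP, hB, hdecomp, intervalIntegral.integral_add hIFd hID, mul_add]
    congr 1
    simp only [hD]
    rw [intervalIntegral.integral_const_mul, intervalIntegral_coboundary_comp_flow Φ hz hW hCW h lag]
  have hstep1 : ∫⁻ z, ENNReal.ofReal (Real.exp (h⁻¹ * ∫ s in (0 : ℝ)..h, F (Φ.flow s z))) ∂μ =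
      ∫⁻ z, (X * Y) z ∂μ := by
    refine lintegral_congr_ae (hae.mono fun z hz => ?_)
    simp only [Pi.mul_apply, hX, hY]
    rw [hsplit z hz, Real.exp_add, ENNReal.ofReal_mul (Real.exp_pos _).le]
  -- (2) Cauchy–Schwarz
  have hstep2 := ENNReal.lintegral_mul_le_Lp_mul_Lq μ Real.HolderConjugate.two_two hXm hYm
  -- (3) first factor: Jensen in time + invariance
  have hX2 : ∫⁻ z, X z ^ (2 : ℝ) ∂μ ≤ ∫⁻ z, ENNReal.ofReal (Real.exp (2 * Fd z)) ∂μ := by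
    have hrw : ∀ z, X z ^ (2 : ℝ) =
        ENNReal.ofReal (Real.exp (h⁻¹ * ∫ s in (0 : ℝ)..(0 + h), 2 * Fd (Φ.flow s z))) := by
      intro z
      rw [hX, ENNReal.ofReal_rpow_of_nonneg (Real.exp_pos _).le (by norm_num), ← Real.exp_mul,
        zero_add, intervalIntegral.integral_const_mul, hP]
      congr 1
      ring
    simp_rw [hrw]
    exact lintegral_exp_windowAverage_le Φ μ hinv hgood hFd2m hFd2b 0 hh
  -- (4) second factor: `e^{2B} ≤ ½(e^{A₁} + e^{A₂})`, then Jensen in time + invariance twice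
  set A₁ : Config N (Fin 3) T3 → ℝ := fun z => lag⁻¹ * ∫ s in h..(h + lag), f₄ (Φ.flow s z) with hA₁
  set A₂ : Config N (Fin 3) T3 → ℝ := fun z => lag⁻¹ * ∫ s in (0 : ℝ)..(0 + lag), f₄ (Φ.flow s z)
    with hA₂
  have hA₁m : AEMeasurable A₁ μ :=
    (Φ.aemeasurable_intervalIntegral_comp_flow_torus hf₄m h (h + lag) hgood).const_mul _
  have hpt : ∀ z, Y z ^ (2 : ℝ) ≤
      2⁻¹ * ENNReal.ofReal (Real.exp (A₁ z)) + 2⁻¹ * ENNReal.ofReal (Real.exp (A₂ z)) := by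
    intro z
    have hI₁ : |∫ s in h..(h + lag), W (Φ.flow s z)| ≤ ∫ s in h..(h + lag), |W (Φ.flow s z)| :=
      intervalIntegral.abs_integral_le_integral_abs (by linarith)
    have hI₂ : |∫ s in (0 : ℝ)..lag, W (Φ.flow s z)| ≤ ∫ s in (0 : ℝ)..lag, |W (Φ.flow s z)| :=
      intervalIntegral.abs_integral_le_integral_abs hlag.le
    have hJ₁ : A₁ z = 4 * h⁻¹ * (lag⁻¹ * ∫ s in h..(h + lag), |W (Φ.flow s z)|) := by
      simp only [hA₁, hf₄]
      rw [intervalIntegral.integral_const_mul]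
      ring
    have hJ₂ : A₂ z = 4 * h⁻¹ * (lag⁻¹ * ∫ s in (0 : ℝ)..lag, |W (Φ.flow s z)|) := by
      simp only [hA₂, hf₄]
      rw [zero_add, intervalIntegral.integral_const_mul]
      ring
    have h2B : 2 * B z ≤ 2⁻¹ * (A₁ z + A₂ z) := by
      rw [hJ₁, hJ₂, hB]
      have hc : 0 ≤ h⁻¹ * lag⁻¹ := by positivity
      have key : (∫ s in h..(h + lag), W (Φ.flow s z)) - ∫ s in (0 : ℝ)..lag, W (Φ.flow s z) ≤
          (∫ s in h..(h + lag), |W (Φ.flow s z)|) + ∫ s in (0 : ℝ)..lag, |W (Φ.flow s z)| := by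
        linarith [le_abs_self (∫ s in h..(h + lag), W (Φ.flow s z)),
          neg_abs_le (∫ s in (0 : ℝ)..lag, W (Φ.flow s z))]
      nlinarith [mul_le_mul_of_nonneg_left key hc]
    calc Y z ^ (2 : ℝ) = ENNReal.ofReal (Real.exp (2 * B z)) := by
          rw [hY, ENNReal.ofReal_rpow_of_nonneg (Real.exp_pos _).le (by norm_num), ← Real.exp_mul,
            mul_comm]
      _ ≤ ENNReal.ofReal (2⁻¹ * (Real.exp (A₁ z) + Real.exp (A₂ z))) :=
          ENNReal.ofReal_le_ofReal ((Real.exp_le_exp.2 h2B).trans (exp_half_add_le _ _))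
      _ = 2⁻¹ * ENNReal.ofReal (Real.exp (A₁ z)) + 2⁻¹ * ENNReal.ofReal (Real.exp (A₂ z)) := by
          rw [ENNReal.ofReal_mul (by norm_num), ENNReal.ofReal_add (Real.exp_pos _).le (Real.exp_pos _).le,
            mul_add, ENNReal.ofReal_inv_of_pos two_pos, ENNReal.ofReal_ofNat]
  have hY2 : ∫⁻ z, Y z ^ (2 : ℝ) ∂μ ≤ ∫⁻ z, ENNReal.ofReal (Real.exp (f₄ z)) ∂μ := by
    have hG₁ : AEMeasurable (fun z => 2⁻¹ * ENNReal.ofReal (Real.exp (A₁ z))) μ :=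
      ((Real.measurable_exp.comp_aemeasurable hA₁m).ennreal_ofReal).const_mul _
    calc ∫⁻ z, Y z ^ (2 : ℝ) ∂μ
        ≤ ∫⁻ z, (2⁻¹ * ENNReal.ofReal (Real.exp (A₁ z)) + 2⁻¹ * ENNReal.ofReal (Real.exp (A₂ z))) ∂μ :=
          lintegral_mono hpt
      _ = 2⁻¹ * ∫⁻ z, ENNReal.ofReal (Real.exp (A₁ z)) ∂μ +
            2⁻¹ * ∫⁻ z, ENNReal.ofReal (Real.exp (A₂ z)) ∂μ := by
          rw [lintegral_add_left' hG₁, lintegral_const_mul' _ _ (by norm_num),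
            lintegral_const_mul' _ _ (by norm_num)]
      _ ≤ 2⁻¹ * ∫⁻ z, ENNReal.ofReal (Real.exp (f₄ z)) ∂μ +
            2⁻¹ * ∫⁻ z, ENNReal.ofReal (Real.exp (f₄ z)) ∂μ := by
          gcongr 2⁻¹ * ?_ + 2⁻¹ * ?_
          · exact lintegral_exp_windowAverage_le Φ μ hinv hgood hf₄m hf₄b h hlag
          · exact lintegral_exp_windowAverage_le Φ μ hinv hgood hf₄m hf₄b 0 hlag
      _ = ∫⁻ z, ENNReal.ofReal (Real.exp (f₄ z)) ∂μ := by
          rw [← add_mul, ENNReal.inv_two_add_inv_two, one_mul]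
  -- (5) assemble
  calc ∫⁻ z, ENNReal.ofReal (Real.exp (h⁻¹ * ∫ s in (0 : ℝ)..h, F (Φ.flow s z))) ∂μ
      = ∫⁻ z, (X * Y) z ∂μ := hstep1
    _ ≤ (∫⁻ z, X z ^ (2 : ℝ) ∂μ) ^ (1 / 2 : ℝ) * (∫⁻ z, Y z ^ (2 : ℝ) ∂μ) ^ (1 / 2 : ℝ) := hstep2
    _ ≤ (∫⁻ z, ENNReal.ofReal (Real.exp (2 * Fd z)) ∂μ) ^ (1 / 2 : ℝ) *
          (∫⁻ z, ENNReal.ofReal (Real.exp (f₄ z)) ∂μ) ^ (1 / 2 : ℝ) :=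
        mul_le_mul' (ENNReal.rpow_le_rpow hX2 (by norm_num)) (ENNReal.rpow_le_rpow hY2 (by norm_num))

end AntiMazurCertificate

/-- **`PressureCertificateTransfer`** (route `AntiMazurCoboundaries`, stmt-AtomisticToContinuum-14139): the
corrector statement `CorrectorPressureDecay` implies the LD-Drude input `KineticFluxLdDecay`. Take `τ := τ₀` and
the same `σ₀, κ, N₀`; for `N ≥ N₀` and a flow `Φ` apply the exponential certificate
`AntiMazurCertificate.lintegral_exp_window_le` to the constant-profile Gibbs law `G_N` (invariant under every
flow map, `measurePreserving_flow_localGibbsLaw_const`; carried by the good set since `G_N ≪` Liouville), the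
one-body observable `F = Σᵢ φ(xᵢ) g((vᵢ − u₀)/√θ)` (measurable, `|F| ≤ (N+1)κ`), the corrector `W` and the lag
given by `CorrectorPressureDecay`, and the window `h = τ₀ (N+1)^{-1/3}`: the defect and cost factors are each
`≤ (e^{δ(N+1)})^{1/2}`. [folklore] -/
theorem pressureCertificateTransfer_proof :
    Summit.AtomisticToContinuum.HydrodynamicLimit.Theses.AntiMazurCoboundaries.PressureCertificateTransfer := by
  intro hX a θ u₀ ha hθ
  obtain ⟨σ₀, hσ₀, hσ⟩ := hX a θ u₀ ha hθ
  refine ⟨σ₀, hσ₀, fun σ hσpos hσlt => ?_⟩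
  obtain ⟨hprob, κ, hκ, hmain⟩ := hσ σ hσpos hσlt
  refine ⟨hprob, κ, hκ, fun φ g hφ hg hφb hgb horth δ hδ => ?_⟩
  obtain ⟨τ₀, hτ₀, N₀, hN⟩ := hmain φ g hφ hg hφb hgb horth δ hδ
  refine ⟨τ₀, hτ₀, N₀, fun N hNN Φ => ?_⟩
  obtain ⟨lag, hlag, W, hWm, hWb, h1, h2⟩ := hN N hNN Φ
  haveI : IsProbabilityMeasure (localGibbsLaw σ (fun _ => a) (fun _ => u₀) (fun _ => θ) N Φ) := hprob N Φ
  have hhpos : 0 < τ₀ * ((N + 1 : ℕ) : ℝ) ^ (-(1 / 3 : ℝ)) :=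
    mul_pos hτ₀ (Real.rpow_pos_of_pos (by positivity) _)
  -- the one-body observable
  have hFm : Measurable fun z : Config (N + 1) (Fin 3) T3 =>
      ∑ i, φ (z i).1 * g ((Real.sqrt θ)⁻¹ • ((z i).2 - u₀)) :=
    Finset.measurable_sum _ fun i _ => (hφ.measurable.comp (measurable_pi_apply i).fst).mul
      (hg.measurable.comp ((measurable_const_smul _).comp ((measurable_pi_apply i).snd.sub_const u₀)))
  have hFb : ∃ C : ℝ, ∀ z : Config (N + 1) (Fin 3) T3,
      |∑ i, φ (z i).1 * g ((Real.sqrt θ)⁻¹ • ((z i).2 - u₀))| ≤ C := by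
    refine ⟨∑ _i : Fin (N + 1), κ, fun z => (Finset.abs_sum_le_sum_abs _ _).trans
      (Finset.sum_le_sum fun i _ => ?_)⟩
    rw [abs_mul]
    calc |φ (z i).1| * |g ((Real.sqrt θ)⁻¹ • ((z i).2 - u₀))| ≤ 1 * κ :=
          mul_le_mul (hφb _) (hgb _) (abs_nonneg _) zero_le_one
      _ = κ := one_mul κ
  -- invariance and support of the global Gibbs law
  have hinv : ∀ t, MeasurePreserving (Φ.flow t)
      (localGibbsLaw σ (fun _ => a) (fun _ => u₀) (fun _ => θ) N Φ)
      (localGibbsLaw σ (fun _ => a) (fun _ => u₀) (fun _ => θ) N Φ) :=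
    fun t => measurePreserving_flow_localGibbsLaw_const σ a θ u₀ N Φ t
  have hgood : localGibbsLaw σ (fun _ => a) (fun _ => u₀) (fun _ => θ) N Φ Φ.goodᶜ = 0 := by
    have hac : localGibbsLaw σ (fun _ => a) (fun _ => u₀) (fun _ => θ) N Φ ≪
        liouville (Torus.geometry (Fin 3)) (N + 1) (hsDiameter σ N) := by
      unfold localGibbsLaw
      rw [particleLaw_eq]
      exact withDensity_absolutelyContinuous _ _
    exact hac Φ.measure_compl_good
  have hC := AntiMazurCertificate.lintegral_exp_window_le Φ
    (localGibbsLaw σ (fun _ => a) (fun _ => u₀) (fun _ => θ) N Φ) hinv hgood hFm hWm hFb hWb hhpos hlag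
  refine hC.trans ?_
  set c : ℝ≥0∞ := ENNReal.ofReal (Real.exp (δ * (N + 1))) with hc
  have hhalf : c ^ (1 / 2 : ℝ) * c ^ (1 / 2 : ℝ) = c := by
    rw [← ENNReal.rpow_add_of_nonneg _ _ (by norm_num : (0 : ℝ) ≤ 1 / 2) (by norm_num : (0 : ℝ) ≤ 1 / 2)]
    norm_num
  calc (∫⁻ z, ENNReal.ofReal (Real.exp (2 * ((∑ i, φ (z i).1 * g ((Real.sqrt θ)⁻¹ • ((z i).2 - u₀))) -
          lag⁻¹ * (W (Φ.flow lag z) - W z))))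
          ∂(localGibbsLaw σ (fun _ => a) (fun _ => u₀) (fun _ => θ) N Φ)) ^ (1 / 2 : ℝ) *
        (∫⁻ z, ENNReal.ofReal (Real.exp (4 * (τ₀ * ((N + 1 : ℕ) : ℝ) ^ (-(1 / 3 : ℝ)))⁻¹ * |W z|))
          ∂(localGibbsLaw σ (fun _ => a) (fun _ => u₀) (fun _ => θ) N Φ)) ^ (1 / 2 : ℝ)
      ≤ c ^ (1 / 2 : ℝ) * c ^ (1 / 2 : ℝ) :=
        mul_le_mul' (ENNReal.rpow_le_rpow h1 (by norm_num)) (ENNReal.rpow_le_rpow h2 (by norm_num))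
    _ = c := hhalf

end Summit.AtomisticToContinuum.HydrodynamicLimit.Theorems

end
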